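import Mathlib
import Summits.ResolutionOfSingularities.ResolutionOfSingularities.Theorems.WildQuotientsWildQuotientResolutionCyclicTransfer
import Summits.ResolutionOfSingularities.ResolutionOfSingularities.Theorems.WildQuotientsWildQuotientResolutionAffineQuotientData
import Summits.ResolutionOfSingularities.ResolutionOfSingularities.Theorems.WildQuotientsWildQuotientResolutionAffineQuotientEtale
import Summits.ResolutionOfSingularities.ResolutionOfSingularities.Theorems.WildQuotientsWildQuotientResolutionTwoBlocksCentreStable
import Summits.ResolutionOfSingularities.ResolutionOfSingularities.Theorems.WildQuotientsWildQuotientResolutionNBlocksAlgebra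
import Summits.ResolutionOfSingularities.ResolutionOfSingularities.Theorems.WildQuotientsWildQuotientResolutionFixedPointsGraded
import Literature.AlgebraicGeometry.Resolution.ProjectiveSpaceRegular
import HarnessLib

/-!
# `𝔸²ⁿ/(J₂^{⊕n})` has a resolution, GIVEN a terminal model (chain w45c, programme T, stretch: the assembly)

(crux stmt-ResolutionOfSingularities-15640 `WildQuotients.WildQuotientResolution`, line `Sketch`,
programme «INSTANTIATE T1», stretch `𝔸²ⁿ/(J₂^{⊕n})` of `L/w45c/CHAIN.md` §5 — NOT Cohen–Macaulay
for `n ≥ 3` (Ellingsrud–Skjelbred); [OURS · L1 W4.5c] — NOT a statement of any manuscript.)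

For `σ = J₂^{⊕n}` on `k[x_{0,i}, x_{1,i} : i < n]` (`n ≥ 1`, characteristic `p`, any prime `p`):
* `idealSheaf_centre_comap` — the ideal sheaf of the centre `(x_{0,i} : i)` on `𝔸²ⁿ` is stable
  under every action `ρ g = Spec (g⁻¹)` of `⟨σ⟩` (the hypothesis of `IsBlowup.liftAction`);
* `nBlocksQuotient_hasResolution_of_model` — `Spec k[x]^σ` has a resolution of singularities AS
  SOON AS the action admits a Király–Lütkebohmert terminal model (`hmodel`, the ∃-body of
  `CyclicTransfer.CyclicDivisorialModelsLE`; intended: `Bl_{(x_{0,i})} 𝔸²ⁿ`, regular etc. by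
  `NBlocks.nBlocks_blowup_regular`, terminal by `NBlocks.augIdeal_eq_centre` and the equivariant
  blow-up lemma of `…TerminalBlowup`): affine quotient data (`…AffineQuotientData`), generic
  étaleness over `D(x_{0,0})` (`…AffineQuotientEtale`, `NBlocks.X_fst_mem_augIdeal`), `|⟨σ⟩| = p`
  (`NBlocks.nBlocks_order`), `dim = 2n > 0`, fed to `CyclicTransfer.cyclicDivisorialTransfer_of_card`.
The case `n = 2` in coordinates `Fin 4` is `TwoBlocks.twoJordanBlocksFourfold_hasResolution_of_model`.
-/

-- single-problem summit: the doubled namespace component `ResolutionOfSingularities` is forced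
set_option linter.dupNamespace false

noncomputable section

open CategoryTheory AlgebraicGeometry TopologicalSpace MvPolynomial
open scoped Pointwise
open Literature.AlgebraicGeometry.Resolution

namespace Summit.ResolutionOfSingularities.ResolutionOfSingularities.Theorems.WildQuotientResolution.NBlocks

/-- **The ideal sheaf of the centre `(x_{0,i} : i)` on `𝔸²ⁿ` is stable under the action of `⟨σ⟩`**
(`ρ g = Spec (g⁻¹)`) — the hypothesis `hρ` of `IsBlowup.liftAction` for `Bl_{(x_{0,i})} 𝔸²ⁿ`.
[folklore] -/
theorem idealSheaf_centre_comap (k : Type) [Field k] (n : ℕ)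
    (σ : MvPolynomial (Fin 2 × Fin n) k ≃ₐ[k] MvPolynomial (Fin 2 × Fin n) k)
    (h0 : ∀ i, σ (X (0, i)) = X (0, i))
    (ρ : ↥(Subgroup.zpowers σ) →* Aut (Spec (CommRingCat.of (MvPolynomial (Fin 2 × Fin n) k))))
    (hρ : ∀ g : ↥(Subgroup.zpowers σ), (ρ g).hom = Spec.map (CommRingCat.ofHom
      ((MulSemiringAction.toRingEquiv (↥(Subgroup.zpowers σ)) (MvPolynomial (Fin 2 × Fin n) k) g⁻¹ :
        MvPolynomial (Fin 2 × Fin n) k ≃+* MvPolynomial (Fin 2 × Fin n) k) :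
          MvPolynomial (Fin 2 × Fin n) k →+* MvPolynomial (Fin 2 × Fin n) k)))
    (g : ↥(Subgroup.zpowers σ)) :
    (affineBlowup.idealSheaf (Ideal.span (Set.range fun i : Fin n =>
        (X (0, i) : MvPolynomial (Fin 2 × Fin n) k)))).comap (ρ g).hom =
      affineBlowup.idealSheaf (Ideal.span (Set.range fun i : Fin n =>
        (X (0, i) : MvPolynomial (Fin 2 × Fin n) k))) :=
  AffineQuotient.idealSheaf_comap_specAction ρ hρ _ (smul_centre_eq k n σ h0) g

/-- **Assembly (stretch of programme T): `𝔸²ⁿ/(J₂^{⊕n})` has a resolution, given a terminal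
model.** For `σ = J₂^{⊕n}` on `k[x_{0,i}, x_{1,i}]` (`n ≥ 1`) over a field of characteristic `p` and
EVERY action `ρ : ⟨σ⟩ →* Aut 𝔸²ⁿ` with `ρ g = Spec (g⁻¹)` admitting a Király–Lütkebohmert terminal
model (`hmodel`), the quotient `Spec k[x]^σ` has a resolution of singularities
(`CyclicTransfer.cyclicDivisorialTransfer_of_card` on the affine quotient data; étale over
`D(x_{0,0})`; `dim = 2n > 0`). For `n ≥ 3` these are the first NON-Cohen–Macaulay wild quotient
singularities in view (Ellingsrud–Skjelbred). [cite: KiralyLutkebohmert2013, Thm 2]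
[cite: SGA1, Exp. V, §1–2] -/
theorem nBlocksQuotient_hasResolution_of_model (p : ℕ) (hp : p.Prime) (k : Type) [Field k]
    [CharP k p] (n : ℕ) (hn : 0 < n)
    (σ : MvPolynomial (Fin 2 × Fin n) k ≃ₐ[k] MvPolynomial (Fin 2 × Fin n) k)
    (h0 : ∀ i, σ (X (0, i)) = X (0, i)) (h1 : ∀ i, σ (X (1, i)) = X (1, i) + X (0, i))
    (hmodel : ∀ (ρ : ↥(Subgroup.zpowers σ) →*
        Aut (Spec (CommRingCat.of (MvPolynomial (Fin 2 × Fin n) k)))),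
      (∀ g : ↥(Subgroup.zpowers σ), (ρ g).hom = Spec.map (CommRingCat.ofHom
        ((MulSemiringAction.toRingEquiv (↥(Subgroup.zpowers σ)) (MvPolynomial (Fin 2 × Fin n) k) g⁻¹ :
          MvPolynomial (Fin 2 × Fin n) k ≃+* MvPolynomial (Fin 2 × Fin n) k) :
            MvPolynomial (Fin 2 × Fin n) k →+* MvPolynomial (Fin 2 × Fin n) k))) →
      ∃ (V : Scheme.{0}) (π : V ⟶ Spec (CommRingCat.of (MvPolynomial (Fin 2 × Fin n) k)))
        (ρV : ↥(Subgroup.zpowers σ) →* Aut V), IsProper π ∧ IsBirational π ∧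
        IsIntegral V ∧ Scheme.IsRegular V ∧
        (∀ g : ↥(Subgroup.zpowers σ), (ρV g).hom ≫ π = π ≫ (ρ g).hom) ∧
        (∀ v : V, ∃ W : V.Opens, IsAffineOpen W ∧ v ∈ W ∧
          ∀ g : ↥(Subgroup.zpowers σ), (ρV g).hom ⁻¹ᵁ W = W) ∧
        ∀ (g : ↥(Subgroup.zpowers σ)) (v : V) (hv : (ρV g).hom.base v = v),
          (Ideal.span (Set.range fun s : V.presheaf.stalk v =>
            (V.presheaf.stalkSpecializes (specializes_of_eq hv) ≫ (ρV g).hom.stalkMap v).hom s -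
              s)).IsPrincipal) :
    Scheme.HasResolution
      (Spec (.of (FixedPoints.subalgebra k (MvPolynomial (Fin 2 × Fin n) k)
        (Subgroup.zpowers σ)))) := by
  classical
  haveI : Fact p.Prime := ⟨hp⟩
  obtain ⟨hσp, -, hcard⟩ := nBlocks_order k n σ h0 h1 p hp hn
  -- the rings: `S = k[x]`, `G = ⟨σ⟩`, `A = S^G`
  let S : Type := MvPolynomial (Fin 2 × Fin n) k
  let G : Type := ↥(Subgroup.zpowers σ)
  haveI : Finite G := Nat.finite_of_card_ne_zero (hcard ▸ hp.ne_zero)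
  let A : Subalgebra k S := FixedPoints.subalgebra k S G
  -- the action on `𝔸²ⁿ` and its terminal model
  obtain ⟨ρ, hρ⟩ := AffineQuotient.exists_specAction S G
  obtain ⟨V, π, ρV, hVprop, hbir, hVint, hVreg, hequiv, hcov, hdiv⟩ := hmodel ρ hρ
  haveI := hVprop
  haveI := hVint
  -- the quotient data
  let f : Spec (.of A) ⟶ Spec (.of k) := Spec.map (CommRingCat.ofHom (algebraMap k A))
  let q : Spec (.of S) ⟶ Spec (.of A) := Spec.map (CommRingCat.ofHom (algebraMap A S))
  haveI : LocallyOfFiniteType f := AffineQuotient.locallyOfFiniteType_specMap_fixedPoints k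
  haveI : IsFinite q := AffineQuotient.isFinite_specMap_fixedPoints k
  have hsurj : Function.Surjective q.base := AffineQuotient.surjective_specMap_fixedPoints k
  have hρq : ∀ g : G, (ρ g).hom ≫ q = q := AffineQuotient.specAction_comp k ρ hρ
  have horb : ∀ x y : Spec (CommRingCat.of S), q.base x = q.base y →
      ∃ g : G, (ρ g).hom.base x = y :=
    fun x y hxy => AffineQuotient.exists_specAction_base_eq k ρ hρ x y hxy
  -- generically étale: over `D(x_{0,0})`
  have hX0 : (X (0, (⟨0, hn⟩ : Fin n)) : S) ∈ A :=
    (TameTransfer.mem_fixedPoints_zpowers_iff_apply_eq σ (X (0, ⟨0, hn⟩))).mpr (h0 ⟨0, hn⟩)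
  have ht0 : (⟨X (0, ⟨0, hn⟩), hX0⟩ : A) ≠ 0 := fun h =>
    MvPolynomial.X_ne_zero ((0 : Fin 2), (⟨0, hn⟩ : Fin n))
      (congrArg Subtype.val h : ((⟨X (0, ⟨0, hn⟩), hX0⟩ : A) : S) = ((0 : A) : S))
  have hU : ∃ U : (Spec (.of A)).Opens, Dense (U : Set (Spec (.of A))) ∧ Etale (q ∣_ U) :=
    AffineQuotient.exists_dense_etale_morphismRestrict k (⟨X (0, ⟨0, hn⟩), hX0⟩ : A) ht0
      fun g hg => X_fst_mem_augIdeal k n σ h0 h1 p hp g hg ⟨0, hn⟩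
  -- `dim X₁ = dim 𝔸²ⁿ = 2n > 0`
  have hdim : ¬ topologicalKrullDim (Spec (CommRingCat.of A)) ≤ 0 := by
    rw [AffineQuotient.topologicalKrullDim_spec_fixedPoints k]
    change ¬ topologicalKrullDim (PrimeSpectrum (MvPolynomial (Fin 2 × Fin n) k)) ≤ 0
    rw [PrimeSpectrum.topologicalKrullDim_eq_ringKrullDim,
      MvPolynomial.ringKrullDim_of_isNoetherianRing, ringKrullDim_eq_zero_of_field, zero_add,
      Nat.card_eq_fintype_card, Fintype.card_prod, Fintype.card_fin, Fintype.card_fin]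
    have h2n : (0 : WithBot ℕ∞) < ((2 * n : ℕ) : WithBot ℕ∞) := by
      exact_mod_cast (by omega : 0 < 2 * n)
    exact not_le.mpr h2n
  -- the transfer
  exact CyclicTransfer.cyclicDivisorialTransfer_of_card p hp k (Spec (.of S)) (Spec (.of A)) f q G ρ
    hcard hdim hsurj hU hρq horb V π ρV hbir hVreg hequiv hcov hdiv

end Summit.ResolutionOfSingularities.ResolutionOfSingularities.Theorems.WildQuotientResolution.NBlocks

end
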